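import Mathlib
import HarnessLib
import Summits.ValiantsHypothesis.ValiantsHypothesis.Theorems.LacunarySymmetroidMatrixDescartesProductPlusOneRowTowerKDefs8
import Summits.ValiantsHypothesis.ValiantsHypothesis.Theorems.LacunarySymmetroidMatrixDescartesProductPlusOneRowTowerKTwoLetter

/-!
# LINE (A) `product_plus_one` (crux `MatrixDescartes`, stmt-ValiantsHypothesis-18050, V1) — W-CB §30, LETTER IMAGES AT ORDER 8, EVERY K:
# the order-8 closure of a binomial row (`ψ₅`, `ψ₇` as polynomials in `ψ₁`) and its image `Λ(λ²)ψ₁ + ψ₁²(c₂ + c₃ψ₁ + 5040ψ₁²)`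

Companion of ✓ `…RowTowerKCalculus` §5 (`rowPsiK3_single_law`) / ✓ `…RowTowerKTwoLetter` (`rowPsiK3_pair_law`) two orders up, in the every-K θ-tower
✓ `…RowTowerKDefs` / ✓ `…RowTowerKDefs8`.  A BINOMIAL row of a K-nomial company is either a bottom letter `A` plus ONE tail letter `l₀` (rate
`λ = λ_{l₀}`), or (`A = 0`) two tail letters `i ≠ j` (rate `λ = λ_j − λ_i`).  Its tower closes on `ψ₁`:
* `rowPsiK5_single_law` / `rowPsiK7_single_law` — `ψ₅ = λ⁴ψ₁ + 30λ²ψ₁² + 120ψ₁³`, `ψ₇ = λ⁶ψ₁ + 126λ⁴ψ₁² + 1680λ²ψ₁³ + 5040ψ₁⁴` (PURE identities in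
  `(B_{l₀}x^λ, u)`, no non-vanishing needed — like ✓ `rowPsiK3_single_law`); `rowPsiK5_pair_law` / `rowPsiK7_pair_law` — the same for `A = 0` two-letter rows
  (needs the row `≠ 0`; `field_simp`);
* ★ `rowPsiK_image8_single_eq` / ★ `rowPsiK_image8_pair_eq` — for ANY reals `e₁ e₂ e₃`:
  `ψ₇ − e₁ψ₅ + e₂ψ₃ − e₃ψ₁ = (λ⁶ − e₁λ⁴ + e₂λ² − e₃)·ψ₁ + ψ₁²·((126λ⁴ − 30e₁λ² + 6e₂) + (1680λ² − 120e₁)·ψ₁ + 5040·ψ₁²)`;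
  when `λ²` is a root of `Λ(t) = t³ − e₁t² + e₂t − e₃` the linear term dies and the image is `ψ₁²·Q_λ(ψ₁)` — E1/E3a's `Q_r(ψ₁) = 6(21r⁴ − 5e₁r² + e₂)ψ₁²
  + 120(14r² − e₁)ψ₁³ + 5040ψ₁⁴` (val-lit-p7 g18, K = 3 binomial currency) for every support size;
* ★ `rowPsiK_image8_single_pos_of_bracket` / ★ `rowPsiK_image8_pair_pos_of_bracket` — `Λ(λ²) = 0`, `ψ₁ ≠ 0`, bracket `c₂ + c₃ψ₁ + 5040ψ₁² > 0` ⇒ image `> 0`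
  (the form the every-K order-6 image cell ✓⧗ `wronskianK_roots_le_six_of_rowImages` consumes; poles and ring-free knees).
HONEST FRAMING: per-row algebra (helper); nothing about `WronskianBudgetK3` / `OneChangeFloorK3` / 18050 / `MatrixDescartes`; `VP ≠ VNP` is NOT proved.
No definitions, no named facts, no sorry.
-/

set_option linter.dupNamespace false

namespace Summit.ValiantsHypothesis.ValiantsHypothesis.Theorems.LacunarySymmetroidMatrixDescartes

namespace ProductPlusOne

open Finset
open scoped BigOperators

variable {n : ℕ} (lam : Fin n → ℕ) (A : ℝ) (B : Fin n → ℝ)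

/-! ### §1 Single tail letter: the order-8 closure (pure identities) -/

/-- `ψ₅ = λ⁴ψ₁ + 30λ²ψ₁² + 120ψ₁³` for a row with ONE tail letter `l₀` (any signs, pure identity). [this file's lemma] -/
theorem rowPsiK5_single_law (l₀ : Fin n) (hB : ∀ l, l ≠ l₀ → B l = 0) (x : ℝ) :
    rowPsiK5 lam A B x = ((lam l₀ : ℕ) : ℝ) ^ 4 * rowPsiK1 lam A B x + 30 * ((lam l₀ : ℕ) : ℝ) ^ 2 * rowPsiK1 lam A B x ^ 2
      + 120 * rowPsiK1 lam A B x ^ 3 := by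
  unfold rowPsiK5 rowPsiK1
  simp only [rowHK_single lam B l₀ hB]
  ring

/-- `ψ₇ = λ⁶ψ₁ + 126λ⁴ψ₁² + 1680λ²ψ₁³ + 5040ψ₁⁴` for a row with ONE tail letter `l₀` (any signs, pure identity). [this file's lemma] -/
theorem rowPsiK7_single_law (l₀ : Fin n) (hB : ∀ l, l ≠ l₀ → B l = 0) (x : ℝ) :
    rowPsiK7 lam A B x = ((lam l₀ : ℕ) : ℝ) ^ 6 * rowPsiK1 lam A B x + 126 * ((lam l₀ : ℕ) : ℝ) ^ 4 * rowPsiK1 lam A B x ^ 2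
      + 1680 * ((lam l₀ : ℕ) : ℝ) ^ 2 * rowPsiK1 lam A B x ^ 3 + 5040 * rowPsiK1 lam A B x ^ 4 := by
  unfold rowPsiK7 rowPsiK1
  simp only [rowHK_single lam B l₀ hB]
  ring

/-- ★ **Order-8 image of a single-letter row** (any reals `e₁ e₂ e₃`):
`ψ₇ − e₁ψ₅ + e₂ψ₃ − e₃ψ₁ = Λ(λ²)·ψ₁ + ψ₁²·(c₂ + c₃ψ₁ + 5040ψ₁²)`, `Λ(t) = t³ − e₁t² + e₂t − e₃`, `c₂ = 126λ⁴ − 30e₁λ² + 6e₂`, `c₃ = 1680λ² − 120e₁`.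
[this file's theorem] -/
theorem rowPsiK_image8_single_eq (l₀ : Fin n) (hB : ∀ l, l ≠ l₀ → B l = 0) (e₁ e₂ e₃ x : ℝ) :
    rowPsiK7 lam A B x - e₁ * rowPsiK5 lam A B x + e₂ * rowPsiK3 lam A B x - e₃ * rowPsiK1 lam A B x
      = (((lam l₀ : ℕ) : ℝ) ^ 6 - e₁ * ((lam l₀ : ℕ) : ℝ) ^ 4 + e₂ * ((lam l₀ : ℕ) : ℝ) ^ 2 - e₃) * rowPsiK1 lam A B x
        + rowPsiK1 lam A B x ^ 2 * ((126 * ((lam l₀ : ℕ) : ℝ) ^ 4 - 30 * e₁ * ((lam l₀ : ℕ) : ℝ) ^ 2 + 6 * e₂)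
          + (1680 * ((lam l₀ : ℕ) : ℝ) ^ 2 - 120 * e₁) * rowPsiK1 lam A B x + 5040 * rowPsiK1 lam A B x ^ 2) := by
  have h3 := rowPsiK3_single_law lam A B l₀ hB x
  rw [rowPsiK7_single_law lam A B l₀ hB x, rowPsiK5_single_law lam A B l₀ hB x,
    show rowPsiK3 lam A B x = ((lam l₀ : ℕ) : ℝ) ^ 2 * rowPsiK1 lam A B x + 6 * rowPsiK1 lam A B x ^ 2 by linarith]
  ring

/-- ★ **Single-letter image sign from the ring bracket**: if `λ²` is a root of `Λ`, `ψ₁ ≠ 0` and `c₂ + c₃ψ₁ + 5040ψ₁² > 0` at `x`, the image is `> 0`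
(poles: `ψ₁ > 0`; knees off their ring). [this file's theorem] -/
theorem rowPsiK_image8_single_pos_of_bracket (l₀ : Fin n) (hB : ∀ l, l ≠ l₀ → B l = 0) (e₁ e₂ e₃ : ℝ) {x : ℝ}
    (hroot : ((lam l₀ : ℕ) : ℝ) ^ 6 - e₁ * ((lam l₀ : ℕ) : ℝ) ^ 4 + e₂ * ((lam l₀ : ℕ) : ℝ) ^ 2 - e₃ = 0)
    (hψ : rowPsiK1 lam A B x ≠ 0)
    (hbr : 0 < (126 * ((lam l₀ : ℕ) : ℝ) ^ 4 - 30 * e₁ * ((lam l₀ : ℕ) : ℝ) ^ 2 + 6 * e₂)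
          + (1680 * ((lam l₀ : ℕ) : ℝ) ^ 2 - 120 * e₁) * rowPsiK1 lam A B x + 5040 * rowPsiK1 lam A B x ^ 2) :
    0 < rowPsiK7 lam A B x - e₁ * rowPsiK5 lam A B x + e₂ * rowPsiK3 lam A B x - e₃ * rowPsiK1 lam A B x := by
  rw [rowPsiK_image8_single_eq lam A B l₀ hB e₁ e₂ e₃ x, hroot, zero_mul, zero_add]
  exact mul_pos (by positivity) hbr

/-! ### §2 Two tail letters, no bottom letter (`A = 0`): the order-8 closure -/

/-- `ψ₅ = λ⁴ψ₁ + 30λ²ψ₁² + 120ψ₁³` with `λ = λ_j − λ_i` for an `A = 0` two-letter row that does not vanish. [this file's lemma] -/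
theorem rowPsiK5_pair_law (i j : Fin n) (hij : i ≠ j) (hB : ∀ l, l ≠ i → l ≠ j → B l = 0) {x : ℝ}
    (hF : (0 : ℝ) - ∑ l, B l * x ^ (lam l) ≠ 0) :
    rowPsiK5 lam 0 B x = (((lam j : ℕ) : ℝ) - ((lam i : ℕ) : ℝ)) ^ 4 * rowPsiK1 lam 0 B x
      + 30 * (((lam j : ℕ) : ℝ) - ((lam i : ℕ) : ℝ)) ^ 2 * rowPsiK1 lam 0 B x ^ 2 + 120 * rowPsiK1 lam 0 B x ^ 3 := by
  have hF2 : (0 : ℝ) - B i * x ^ (lam i) - B j * x ^ (lam j) ≠ 0 := by rwa [row_pair lam 0 B i j hij hB] at hF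
  unfold rowPsiK5 rowPsiK1 rowUK
  simp only [rowHK_pair lam B i j hij hB, row_pair lam 0 B i j hij hB]
  field_simp
  ring

/-- `ψ₇ = λ⁶ψ₁ + 126λ⁴ψ₁² + 1680λ²ψ₁³ + 5040ψ₁⁴` with `λ = λ_j − λ_i` for an `A = 0` two-letter row that does not vanish. [this file's lemma] -/
theorem rowPsiK7_pair_law (i j : Fin n) (hij : i ≠ j) (hB : ∀ l, l ≠ i → l ≠ j → B l = 0) {x : ℝ}
    (hF : (0 : ℝ) - ∑ l, B l * x ^ (lam l) ≠ 0) :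
    rowPsiK7 lam 0 B x = (((lam j : ℕ) : ℝ) - ((lam i : ℕ) : ℝ)) ^ 6 * rowPsiK1 lam 0 B x
      + 126 * (((lam j : ℕ) : ℝ) - ((lam i : ℕ) : ℝ)) ^ 4 * rowPsiK1 lam 0 B x ^ 2
      + 1680 * (((lam j : ℕ) : ℝ) - ((lam i : ℕ) : ℝ)) ^ 2 * rowPsiK1 lam 0 B x ^ 3 + 5040 * rowPsiK1 lam 0 B x ^ 4 := by
  have hF2 : (0 : ℝ) - B i * x ^ (lam i) - B j * x ^ (lam j) ≠ 0 := by rwa [row_pair lam 0 B i j hij hB] at hF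
  unfold rowPsiK7 rowPsiK1 rowUK
  simp only [rowHK_pair lam B i j hij hB, row_pair lam 0 B i j hij hB]
  field_simp
  ring

/-- ★ **Order-8 image of an `A = 0` two-letter row** (rate `λ = λ_j − λ_i`, any reals `e₁ e₂ e₃`, row non-vanishing):
`ψ₇ − e₁ψ₅ + e₂ψ₃ − e₃ψ₁ = Λ(λ²)·ψ₁ + ψ₁²·(c₂ + c₃ψ₁ + 5040ψ₁²)`. [this file's theorem] -/
theorem rowPsiK_image8_pair_eq (i j : Fin n) (hij : i ≠ j) (hB : ∀ l, l ≠ i → l ≠ j → B l = 0) (e₁ e₂ e₃ : ℝ) {x : ℝ}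
    (hF : (0 : ℝ) - ∑ l, B l * x ^ (lam l) ≠ 0) :
    rowPsiK7 lam 0 B x - e₁ * rowPsiK5 lam 0 B x + e₂ * rowPsiK3 lam 0 B x - e₃ * rowPsiK1 lam 0 B x
      = ((((lam j : ℕ) : ℝ) - ((lam i : ℕ) : ℝ)) ^ 6 - e₁ * (((lam j : ℕ) : ℝ) - ((lam i : ℕ) : ℝ)) ^ 4
            + e₂ * (((lam j : ℕ) : ℝ) - ((lam i : ℕ) : ℝ)) ^ 2 - e₃) * rowPsiK1 lam 0 B x
        + rowPsiK1 lam 0 B x ^ 2 * ((126 * (((lam j : ℕ) : ℝ) - ((lam i : ℕ) : ℝ)) ^ 4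
              - 30 * e₁ * (((lam j : ℕ) : ℝ) - ((lam i : ℕ) : ℝ)) ^ 2 + 6 * e₂)
          + (1680 * (((lam j : ℕ) : ℝ) - ((lam i : ℕ) : ℝ)) ^ 2 - 120 * e₁) * rowPsiK1 lam 0 B x + 5040 * rowPsiK1 lam 0 B x ^ 2) := by
  have h3 := rowPsiK3_pair_law lam B i j hij hB hF
  rw [rowPsiK7_pair_law lam B i j hij hB hF, rowPsiK5_pair_law lam B i j hij hB hF,
    show rowPsiK3 lam 0 B x = (((lam j : ℕ) : ℝ) - ((lam i : ℕ) : ℝ)) ^ 2 * rowPsiK1 lam 0 B x + 6 * rowPsiK1 lam 0 B x ^ 2 by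
      linarith]
  ring

/-- ★ **Two-letter image sign from the ring bracket** (`A = 0`): `Λ(λ²) = 0` (`λ = λ_j − λ_i`), `ψ₁ ≠ 0`, bracket `> 0` ⇒ image `> 0`. [this file's theorem] -/
theorem rowPsiK_image8_pair_pos_of_bracket (i j : Fin n) (hij : i ≠ j) (hB : ∀ l, l ≠ i → l ≠ j → B l = 0) (e₁ e₂ e₃ : ℝ) {x : ℝ}
    (hF : (0 : ℝ) - ∑ l, B l * x ^ (lam l) ≠ 0)
    (hroot : (((lam j : ℕ) : ℝ) - ((lam i : ℕ) : ℝ)) ^ 6 - e₁ * (((lam j : ℕ) : ℝ) - ((lam i : ℕ) : ℝ)) ^ 4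
        + e₂ * (((lam j : ℕ) : ℝ) - ((lam i : ℕ) : ℝ)) ^ 2 - e₃ = 0)
    (hψ : rowPsiK1 lam 0 B x ≠ 0)
    (hbr : 0 < (126 * (((lam j : ℕ) : ℝ) - ((lam i : ℕ) : ℝ)) ^ 4 - 30 * e₁ * (((lam j : ℕ) : ℝ) - ((lam i : ℕ) : ℝ)) ^ 2 + 6 * e₂)
          + (1680 * (((lam j : ℕ) : ℝ) - ((lam i : ℕ) : ℝ)) ^ 2 - 120 * e₁) * rowPsiK1 lam 0 B x + 5040 * rowPsiK1 lam 0 B x ^ 2) :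
    0 < rowPsiK7 lam 0 B x - e₁ * rowPsiK5 lam 0 B x + e₂ * rowPsiK3 lam 0 B x - e₃ * rowPsiK1 lam 0 B x := by
  rw [rowPsiK_image8_pair_eq lam B i j hij hB e₁ e₂ e₃ hF, hroot, zero_mul, zero_add]
  exact mul_pos (by positivity) hbr

end ProductPlusOne

end Summit.ValiantsHypothesis.ValiantsHypothesis.Theorems.LacunarySymmetroidMatrixDescartes
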